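import Summits.QuantumFields.YangMills.Theorems.ColdStartUniversalityLatticeLangevinHypercontractiveMixing
import HarnessLib

/-!
# Route `ColdStartUniversality` (fixed-cut-off package, `Lᵖ` side): ★★ `Lᵖ`-CONVERGENCE TO EQUILIBRIUM at the `L²` rate for `p ≥ 2`,
# after the hypercontractive waiting time `log(p−1)/(4ρ)`

Helper file (seat `ym-line-csu-p1`, g36; `--supports stmt-QuantumFields-24809`).  SU(2) lattice Langevin dynamics of Shen–Zhu–Zhu at
`(L, β')`, Wilson measure `μ = μ_{β'}`, ANY realising kernel family `κ`.  The `L²` spectral gap `λ` controls `‖κ_tG − μG‖₂`; for `p > 2`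
hypercontractivity (g36) transfers the `L²` rate to `Lᵖ` after the waiting time `t_p` with `e^{4ρt_p} = p − 1`:

* `lqNorm_two_le_lqNorm` — Jensen/Lyapunov on a probability space: `(∫ G² dμ)^{1/2} ≤ (∫ |G|^p dμ)^{1/p}` for `p ≥ 2`, bounded measurable `G`;
* ★★ `lpNorm_transition_centred_le_of_hypercontractive` — under LSI(`ρ`) and gap(`λ`) (hypotheses): for bounded measurable `G`,
  `t_p, s ≥ 0` and `p = 1 + e^{4ρt_p}` (so `p ≥ 2`):
  `(∫ |κ_{t_p+s}G − μG|^p dμ)^{1/p} ≤ e^{−λs}·(∫ |G − μG|^p dμ)^{1/p}`;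
* ★★ `wilson_lpConvergence_explicit` / `wilson_lpConvergence_uniform` — UNCONDITIONAL at every `(L,β')` (`ρ = ½e^{−4|β'|#𝒫}`,
  `λ = (3/2)e^{−4|β'|#𝒫}`) and VOLUME-FREE for `|β'| < 1/12` (`ρ = (1−12|β'|)/2`, `λ = 1 − 12|β'|`).

THEOREMS ONLY, no definition, no sorry.  HONEST FRAMING: RECORD-rung R3 plumbing at FIXED cut-off; nothing K-uniform; no crux, rung or summit
statement is proved; the Yang–Mills mass gap is NOT proved.
-/

set_option autoImplicit false

noncomputable section

namespace Summit.QuantumFields.YangMills.Theorems.ColdStartUniversality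

open MeasureTheory ProbabilityTheory Filter Set Topology
open scoped BigOperators NNReal ENNReal
open Literature.Probability.Process Literature.MathematicalPhysics.QuantumFieldTheory
open Literature.MathematicalPhysics.QuantumLattice (fundamentalRep fundamentalLatticeRep continuous_fundamentalRep)

variable {L : ℕ} [NeZero L]

/-! ## §1. Lyapunov's inequality `‖G‖₂ ≤ ‖G‖_p` on a probability space -/

/-- **`(∫ G² dν)^{1/2} ≤ (∫ |G|^p dν)^{1/p}`** for a probability measure, `p ≥ 2` and bounded measurable `G` (Jensen for the convex
`y ↦ y^{p/2}` applied to `G²`). [folklore] -/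
theorem lqNorm_two_le_lqNorm {Y : Type*} [MeasurableSpace Y] (ν : Measure Y) [IsProbabilityMeasure ν]
    {G : Y → ℝ} (hG : Measurable G) {C : ℝ} (hC : ∀ y, |G y| ≤ C) {p : ℝ} (hp : 2 ≤ p) :
    (∫ y, |G y| ^ (2 : ℝ) ∂ν) ^ (1 / (2 : ℝ)) ≤ (∫ y, |G y| ^ p ∂ν) ^ (1 / p) := by
  have hp0 : 0 < p := by linarith
  have hp2 : 1 ≤ p / 2 := by linarith
  have hGa : Measurable fun y => |G y| := hG.abs
  have hG2m : Measurable fun y => |G y| ^ (2 : ℝ) := (Real.continuous_rpow_const (by norm_num)).measurable.comp hGa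
  have hGpm : Measurable fun y => |G y| ^ p := (Real.continuous_rpow_const hp0.le).measurable.comp hGa
  have i2 : Integrable (fun y => |G y| ^ (2 : ℝ)) ν := integrable_of_abs_le ν hG2m (C := |C| ^ (2 : ℝ)) fun y => by
    rw [abs_of_nonneg (Real.rpow_nonneg (abs_nonneg _) _)]
    exact Real.rpow_le_rpow (abs_nonneg _) ((hC y).trans (le_abs_self C)) (by norm_num)
  have ip : Integrable (fun y => |G y| ^ p) ν := integrable_of_abs_le ν hGpm (C := |C| ^ p) fun y => by
    rw [abs_of_nonneg (Real.rpow_nonneg (abs_nonneg _) _)]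
    exact Real.rpow_le_rpow (abs_nonneg _) ((hC y).trans (le_abs_self C)) hp0.le
  -- Jensen: `(∫ |G|²)^{p/2} ≤ ∫ (|G|²)^{p/2} = ∫ |G|^p`
  have hpow : ∀ y, (|G y| ^ (2 : ℝ)) ^ (p / 2) = |G y| ^ p := fun y => by
    rw [← Real.rpow_mul (abs_nonneg _)]; congr 1; ring
  have ip' : Integrable ((fun x : ℝ => x ^ (p / 2)) ∘ fun y => |G y| ^ (2 : ℝ)) ν := by
    have : ((fun x : ℝ => x ^ (p / 2)) ∘ fun y => |G y| ^ (2 : ℝ)) = fun y => |G y| ^ p := funext fun y => hpow y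
    rw [this]; exact ip
  have hJ := ConvexOn.map_integral_le (μ := ν) (f := fun y => |G y| ^ (2 : ℝ)) (convexOn_rpow hp2)
    (Real.continuous_rpow_const (by linarith)).continuousOn isClosed_Ici
    (Eventually.of_forall fun y => Real.rpow_nonneg (abs_nonneg _) _) i2 ip'
  simp only [hpow] at hJ
  -- take the `1/p`-th power
  have hI0 : 0 ≤ ∫ y, |G y| ^ (2 : ℝ) ∂ν := integral_nonneg fun y => Real.rpow_nonneg (abs_nonneg _) _
  have h := Real.rpow_le_rpow (Real.rpow_nonneg hI0 _) hJ (by positivity : (0 : ℝ) ≤ 1 / p)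
  rw [← Real.rpow_mul hI0] at h
  have e : p / 2 * (1 / p) = 1 / 2 := by field_simp
  rw [e] at h
  exact h

/-! ## §2. `Lᵖ` convergence after the waiting time -/

/-- ★★ **`Lᵖ`-convergence to equilibrium at the `L²` rate, conditional form.**  Under the generator-form log-Sobolev inequality with
constant `ρ ≥ 0` and an `L²` gap `λ` for bounded measurable observables: for bounded measurable `G`, `t_p, s ≥ 0` and
`p = 1 + e^{4ρt_p}`:  `(∫ |κ_{t_p+s}G − μG|^p dμ_{β'})^{1/p} ≤ e^{−λs}·(∫ |G − μG|^p dμ_{β'})^{1/p}`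
(`κ_{t_p+s} = κ_{t_p}κ_s`; hypercontractivity `‖κ_{t_p}‖_{2→p} ≤ 1`; the gap on `κ_s(G − μG)`; `‖·‖₂ ≤ ‖·‖_p`).
[cite: DiaconisSaloffcoste1996, Theorem 3.5 (ii)] -/
theorem lpNorm_transition_centred_le_of_hypercontractive (L : ℕ) [NeZero L] (β' : ℝ)
    (κ : ℝ≥0 → Kernel (GaugeConfig 3 L (Matrix.specialUnitaryGroup (Fin 2) ℂ))
      (GaugeConfig 3 L (Matrix.specialUnitaryGroup (Fin 2) ℂ))) [∀ t, IsMarkovKernel (κ t)]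
    (hreal : ∀ (t : ℝ≥0) (x : GaugeConfig 3 L (Matrix.specialUnitaryGroup (Fin 2) ℂ))
        (Ω : Type) [MeasurableSpace Ω] (P : Measure Ω) [IsProbabilityMeasure P]
        (W : ℝ≥0 → Ω → (Edge 3 L × NoiseIdx 2 → ℝ)) (hW : IsFlatBrownian W P)
        (U : ℝ≥0 → Ω → GaugeConfig 3 L (Matrix.specialUnitaryGroup (Fin 2) ℂ)),
        (∀ ω, U 0 ω = x) →
        (latticeLangevinDynamics (fundamentalLatticeRep 2) β').IsSolution (fundamentalRep (Fin 2))
          hW.natFiltration P W U →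
        κ t x = P.map (U t))
    {ρ : ℝ} (hρ : 0 ≤ ρ)
    (hLSgen : ∀ (f : (Edge 3 L × Fin 2 × Fin 2 × Bool → ℝ) → ℝ), ContDiff ℝ 3 f →
        let coords : GaugeConfig 3 L (Matrix.specialUnitaryGroup (Fin 2) ℂ) → (Edge 3 L × Fin 2 × Fin 2 × Bool → ℝ) :=
          fun V q => (fun z : ℂ => if q.2.2.2 then z.im else z.re)
            ((fundamentalRep (Fin 2) (V q.1) : Matrix (Fin 2) (Fin 2) ℂ) q.2.1 q.2.2.1)
        let gen : GaugeConfig 3 L (Matrix.specialUnitaryGroup (Fin 2) ℂ) → ℝ := fun V =>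
          (∑ i : Edge 3 L × Fin 2 × Fin 2 × Bool, fderiv ℝ f (coords V) (Pi.single i 1) *
              (fun z : ℂ => if i.2.2.2 then z.im else z.re)
                ((latticeLangevinDynamics (fundamentalLatticeRep 2) β').drift
                  (matrixConfig (fundamentalRep (Fin 2)) V) i.1 i.2.1 i.2.2.1) +
          1 / 2 * ∑ i : Edge 3 L × Fin 2 × Fin 2 × Bool, ∑ j : Edge 3 L × Fin 2 × Fin 2 × Bool,
            fderiv ℝ (fun z => fderiv ℝ f z (Pi.single i 1)) (coords V) (Pi.single j 1) *
              ∑ n : Edge 3 L × NoiseIdx 2,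
                (if n.1 = i.1 then (fun z : ℂ => if i.2.2.2 then z.im else z.re)
                  ((latticeLangevinDynamics (fundamentalLatticeRep 2) β').noise
                    (matrixConfig (fundamentalRep (Fin 2)) V) i.1 n.2 i.2.1 i.2.2.1) else 0) *
                (if n.1 = j.1 then (fun z : ℂ => if j.2.2.2 then z.im else z.re)
                  ((latticeLangevinDynamics (fundamentalLatticeRep 2) β').noise
                    (matrixConfig (fundamentalRep (Fin 2)) V) j.1 n.2 j.2.1 j.2.2.1) else 0))
        ρ * ((∫ V, f (coords V) ^ 2 * Real.log (f (coords V) ^ 2) ∂(wilsonMeasure (d := 3) (L := L) (fundamentalRep (Fin 2)) β')) -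
            (∫ V, f (coords V) ^ 2 ∂(wilsonMeasure (d := 3) (L := L) (fundamentalRep (Fin 2)) β')) *
              Real.log (∫ V, f (coords V) ^ 2 ∂(wilsonMeasure (d := 3) (L := L) (fundamentalRep (Fin 2)) β'))) ≤
          -∫ V, f (coords V) * gen V ∂(wilsonMeasure (d := 3) (L := L) (fundamentalRep (Fin 2)) β'))
    {lam : ℝ}
    (hgap : ∀ (G : GaugeConfig 3 L (Matrix.specialUnitaryGroup (Fin 2) ℂ) → ℝ), Measurable G → ∀ M : ℝ, (∀ x, |G x| ≤ M) →
      ∀ t : ℝ≥0,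
        ∫ x, ((∫ y, G y ∂(κ t x)) - ∫ z, G z ∂(wilsonMeasure (d := 3) (L := L) (fundamentalRep (Fin 2)) β')) ^ 2
            ∂(wilsonMeasure (d := 3) (L := L) (fundamentalRep (Fin 2)) β') ≤
          Real.exp (-2 * lam * t) *
            ∫ x, (G x - ∫ z, G z ∂(wilsonMeasure (d := 3) (L := L) (fundamentalRep (Fin 2)) β')) ^ 2
              ∂(wilsonMeasure (d := 3) (L := L) (fundamentalRep (Fin 2)) β'))
    {G : GaugeConfig 3 L (Matrix.specialUnitaryGroup (Fin 2) ℂ) → ℝ} (hG : Measurable G) {M : ℝ} (hM : ∀ x, |G x| ≤ M)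
    (tp s : ℝ≥0) :
    (∫ x, |(∫ y, G y ∂(κ (tp + s) x)) - ∫ z, G z ∂(wilsonMeasure (d := 3) (L := L) (fundamentalRep (Fin 2)) β')| ^
        (1 + Real.exp (4 * ρ * tp)) ∂(wilsonMeasure (d := 3) (L := L) (fundamentalRep (Fin 2)) β')) ^
        (1 / (1 + Real.exp (4 * ρ * tp))) ≤
      Real.exp (-lam * s) *
        (∫ x, |G x - ∫ z, G z ∂(wilsonMeasure (d := 3) (L := L) (fundamentalRep (Fin 2)) β')| ^ (1 + Real.exp (4 * ρ * tp))
          ∂(wilsonMeasure (d := 3) (L := L) (fundamentalRep (Fin 2)) β')) ^ (1 / (1 + Real.exp (4 * ρ * tp))) := by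
  classical
  haveI := secondCountableTopology_su2
  haveI := borelSpace_config L
  set μ : Measure (GaugeConfig 3 L (Matrix.specialUnitaryGroup (Fin 2) ℂ)) :=
    wilsonMeasure (d := 3) (L := L) (fundamentalRep (Fin 2)) β' with hμ
  haveI : IsProbabilityMeasure μ :=
    isProbabilityMeasure_wilsonMeasure (d := 3) (L := L) (fundamentalRep (Fin 2)) (continuous_fundamentalRep (Fin 2)) β'
  set p : ℝ := 1 + Real.exp (4 * ρ * tp) with hp
  have hp2 : 2 ≤ p := by
    have : 1 ≤ Real.exp (4 * ρ * tp) := Real.one_le_exp (by positivity)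
    rw [hp]; linarith
  have hp0 : 0 < p := by linarith
  set m : ℝ := ∫ z, G z ∂μ with hm
  -- the centred observable `Ĝ = G − m`: `κ_t G − m = κ_t Ĝ`
  set Gc : GaugeConfig 3 L (Matrix.specialUnitaryGroup (Fin 2) ℂ) → ℝ := fun x => G x - m with hGc
  have hGcm : Measurable Gc := hG.sub measurable_const
  have hmM : |m| ≤ M := abs_integral_le_of_abs_le_of_isProbabilityMeasure hM
  have hGcb : ∀ x, |Gc x| ≤ M + M := fun x => (abs_sub _ _).trans (add_le_add (hM x) hmM)
  have hκc : ∀ (t : ℝ≥0) x, (∫ y, G y ∂(κ t x)) - m = ∫ y, Gc y ∂(κ t x) := by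
    intro t x
    rw [hGc, integral_sub (integrable_of_abs_le _ hG hM) (integrable_const m)]
    simp
  -- `H = κ_s Ĝ`: bounded measurable, `∫ H² ≤ e^{−2λs} ∫ Ĝ²`
  set H : GaugeConfig 3 L (Matrix.specialUnitaryGroup (Fin 2) ℂ) → ℝ := fun x => ∫ y, Gc y ∂(κ s x) with hH
  have hHm : Measurable H := (hGcm.stronglyMeasurable.integral_kernel (κ := κ s)).measurable
  have hHb : ∀ x, |H x| ≤ M + M := fun x => abs_integral_le_of_abs_le_of_isProbabilityMeasure (μ := κ s x) hGcb
  have hvar : ∫ x, |H x| ^ (2 : ℝ) ∂μ ≤ Real.exp (-2 * lam * s) * ∫ x, |Gc x| ^ (2 : ℝ) ∂μ := by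
    have h1 := hgap G hG M hM s
    have e1 : ∫ x, |H x| ^ (2 : ℝ) ∂μ = ∫ x, ((∫ y, G y ∂(κ s x)) - m) ^ 2 ∂μ :=
      integral_congr_ae (Eventually.of_forall fun x => by simp only [hH, Real.rpow_two, sq_abs, hκc])
    have e2 : ∫ x, |Gc x| ^ (2 : ℝ) ∂μ = ∫ x, (G x - m) ^ 2 ∂μ :=
      integral_congr_ae (Eventually.of_forall fun x => by simp only [hGc, Real.rpow_two, sq_abs])
    rw [e1, e2, hm]; exact h1
  -- Chapman–Kolmogorov: `κ_{t_p+s}G − m = κ_{t_p} H`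
  have hCK : ∀ x, (∫ y, G y ∂(κ (tp + s) x)) - m = ∫ y, H y ∂(κ tp x) := by
    intro x
    rw [hκc, add_comm tp s, ← integral_transition_transition_eq_of_measurable L β' κ hreal hGcm hGcb s tp x]
  -- hypercontractivity `2 → p` for `H` over `t_p`
  have hHC := lqNorm_transition_le_of_generatorLogSobolev_of_measurable L β' κ hreal hρ hLSgen hHm hHb (p := 2) (by norm_num) tp
  have ep : 1 + ((2 : ℝ) - 1) * Real.exp (4 * ρ * tp) = p := by rw [hp]; ring
  rw [ep] at hHC
  -- `‖H‖₂ ≤ e^{−λs} ‖Ĝ‖₂ ≤ e^{−λs} ‖Ĝ‖_p`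
  have hstep2 : (∫ x, |H x| ^ (2 : ℝ) ∂μ) ^ (1 / (2 : ℝ)) ≤ Real.exp (-lam * s) * (∫ x, |Gc x| ^ (2 : ℝ) ∂μ) ^ (1 / (2 : ℝ)) := by
    have h := Real.rpow_le_rpow (integral_nonneg fun x => Real.rpow_nonneg (abs_nonneg _) _) hvar (by norm_num : (0:ℝ) ≤ 1 / 2)
    have e : (Real.exp (-2 * lam * s) * ∫ x, |Gc x| ^ (2 : ℝ) ∂μ) ^ (1 / (2 : ℝ)) =
        Real.exp (-lam * s) * (∫ x, |Gc x| ^ (2 : ℝ) ∂μ) ^ (1 / (2 : ℝ)) := by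
      rw [Real.mul_rpow (Real.exp_pos _).le (integral_nonneg fun x => Real.rpow_nonneg (abs_nonneg _) _)]
      congr 1
      rw [← Real.exp_mul]; congr 1; ring
    rw [e] at h; exact h
  have hstep3 := lqNorm_two_le_lqNorm μ hGcm hGcb hp2
  have e0 : ∫ x, |(∫ y, G y ∂(κ (tp + s) x)) - m| ^ p ∂μ = ∫ x, |∫ y, H y ∂(κ tp x)| ^ p ∂μ :=
    integral_congr_ae (Eventually.of_forall fun x => by
      show |(∫ y, G y ∂(κ (tp + s) x)) - m| ^ p = |∫ y, H y ∂(κ tp x)| ^ p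
      rw [hCK])
  rw [e0]
  calc (∫ x, |∫ y, H y ∂(κ tp x)| ^ p ∂μ) ^ (1 / p) ≤ (∫ x, |H x| ^ (2 : ℝ) ∂μ) ^ (1 / (2 : ℝ)) := hHC
    _ ≤ Real.exp (-lam * s) * (∫ x, |Gc x| ^ (2 : ℝ) ∂μ) ^ (1 / (2 : ℝ)) := hstep2
    _ ≤ Real.exp (-lam * s) * (∫ x, |Gc x| ^ p ∂μ) ^ (1 / p) := mul_le_mul_of_nonneg_left hstep3 (Real.exp_pos _).le

/-! ## §3. Explicit constants -/

/-- ★★ **`Lᵖ`-convergence to equilibrium, UNCONDITIONAL at every fixed cut-off** (`ρ = ½e^{−|β'|·4·#𝒫}`, `λ = (3/2)e^{−|β'|·4·#𝒫}`):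
for bounded measurable `G`, `t_p, s ≥ 0`, `p = 1 + e^{4ρt_p}`:
`(∫ |κ_{t_p+s}G − μG|^p dμ_{β'})^{1/p} ≤ e^{−λs}·(∫ |G − μG|^p dμ_{β'})^{1/p}`. [cite: DiaconisSaloffcoste1996, Theorem 3.5 (ii)] -/
theorem wilson_lpConvergence_explicit (L : ℕ) [NeZero L] (β' : ℝ)
    (κ : ℝ≥0 → Kernel (GaugeConfig 3 L (Matrix.specialUnitaryGroup (Fin 2) ℂ))
      (GaugeConfig 3 L (Matrix.specialUnitaryGroup (Fin 2) ℂ))) [∀ t, IsMarkovKernel (κ t)]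
    (hreal : ∀ (t : ℝ≥0) (x : GaugeConfig 3 L (Matrix.specialUnitaryGroup (Fin 2) ℂ))
        (Ω : Type) [MeasurableSpace Ω] (P : Measure Ω) [IsProbabilityMeasure P]
        (W : ℝ≥0 → Ω → (Edge 3 L × NoiseIdx 2 → ℝ)) (hW : IsFlatBrownian W P)
        (U : ℝ≥0 → Ω → GaugeConfig 3 L (Matrix.specialUnitaryGroup (Fin 2) ℂ)),
        (∀ ω, U 0 ω = x) →
        (latticeLangevinDynamics (fundamentalLatticeRep 2) β').IsSolution (fundamentalRep (Fin 2))
          hW.natFiltration P W U →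
        κ t x = P.map (U t))
    {G : GaugeConfig 3 L (Matrix.specialUnitaryGroup (Fin 2) ℂ) → ℝ} (hG : Measurable G) {M : ℝ} (hM : ∀ x, |G x| ≤ M)
    (tp s : ℝ≥0) :
    (∫ x, |(∫ y, G y ∂(κ (tp + s) x)) - ∫ z, G z ∂(wilsonMeasure (d := 3) (L := L) (fundamentalRep (Fin 2)) β')| ^
        (1 + Real.exp (4 * ((1 / 2 : ℝ) * Real.exp (-(|β'| * (4 * (Fintype.card (Plaquette 3 L) : ℝ))))) * tp))
        ∂(wilsonMeasure (d := 3) (L := L) (fundamentalRep (Fin 2)) β')) ^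
        (1 / (1 + Real.exp (4 * ((1 / 2 : ℝ) * Real.exp (-(|β'| * (4 * (Fintype.card (Plaquette 3 L) : ℝ))))) * tp))) ≤
      Real.exp (-((3 / 2 : ℝ) * Real.exp (-(|β'| * (4 * (Fintype.card (Plaquette 3 L) : ℝ))))) * s) *
        (∫ x, |G x - ∫ z, G z ∂(wilsonMeasure (d := 3) (L := L) (fundamentalRep (Fin 2)) β')| ^
          (1 + Real.exp (4 * ((1 / 2 : ℝ) * Real.exp (-(|β'| * (4 * (Fintype.card (Plaquette 3 L) : ℝ))))) * tp))
          ∂(wilsonMeasure (d := 3) (L := L) (fundamentalRep (Fin 2)) β')) ^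
          (1 / (1 + Real.exp (4 * ((1 / 2 : ℝ) * Real.exp (-(|β'| * (4 * (Fintype.card (Plaquette 3 L) : ℝ))))) * tp))) :=
  lpNorm_transition_centred_le_of_hypercontractive L β' κ hreal
    (ρ := (1 / 2 : ℝ) * Real.exp (-(|β'| * (4 * (Fintype.card (Plaquette 3 L) : ℝ))))) (by positivity)
    (fun f hf => wilson_generatorLogSobolev_explicit L β' f hf)
    (lam := (3 / 2 : ℝ) * Real.exp (-(|β'| * (4 * (Fintype.card (Plaquette 3 L) : ℝ)))))
    (fun G' hG' M' hM' t => wilson_spectralGap_explicit_measurable L β' κ hreal hG' hM' t) hG hM tp s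

/-- ★★ **Volume-free `Lᵖ`-convergence to equilibrium at small `|β'|`** (`|β'| < 1/12`, `ρ = (1 − 12|β'|)/2`, `λ = 1 − 12|β'|`, both
independent of `L`): for bounded measurable `G`, `t_p, s ≥ 0`, `p = 1 + e^{2(1−12|β'|)t_p}`:
`(∫ |κ_{t_p+s}G − μG|^p dμ_{β'})^{1/p} ≤ e^{−(1−12|β'|)s}·(∫ |G − μG|^p dμ_{β'})^{1/p}`.
[cite: DiaconisSaloffcoste1996, Theorem 3.5 (ii)] [cite: ShenZhuZhu2022, Corollary 4.4] -/
theorem wilson_lpConvergence_uniform (L : ℕ) [NeZero L] (β' : ℝ) (hβ : |β'| < 1 / 12)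
    (κ : ℝ≥0 → Kernel (GaugeConfig 3 L (Matrix.specialUnitaryGroup (Fin 2) ℂ))
      (GaugeConfig 3 L (Matrix.specialUnitaryGroup (Fin 2) ℂ))) [∀ t, IsMarkovKernel (κ t)]
    (hreal : ∀ (t : ℝ≥0) (x : GaugeConfig 3 L (Matrix.specialUnitaryGroup (Fin 2) ℂ))
        (Ω : Type) [MeasurableSpace Ω] (P : Measure Ω) [IsProbabilityMeasure P]
        (W : ℝ≥0 → Ω → (Edge 3 L × NoiseIdx 2 → ℝ)) (hW : IsFlatBrownian W P)
        (U : ℝ≥0 → Ω → GaugeConfig 3 L (Matrix.specialUnitaryGroup (Fin 2) ℂ)),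
        (∀ ω, U 0 ω = x) →
        (latticeLangevinDynamics (fundamentalLatticeRep 2) β').IsSolution (fundamentalRep (Fin 2))
          hW.natFiltration P W U →
        κ t x = P.map (U t))
    {G : GaugeConfig 3 L (Matrix.specialUnitaryGroup (Fin 2) ℂ) → ℝ} (hG : Measurable G) {M : ℝ} (hM : ∀ x, |G x| ≤ M)
    (tp s : ℝ≥0) :
    (∫ x, |(∫ y, G y ∂(κ (tp + s) x)) - ∫ z, G z ∂(wilsonMeasure (d := 3) (L := L) (fundamentalRep (Fin 2)) β')| ^
        (1 + Real.exp (4 * ((1 - 12 * |β'|) / 2) * tp)) ∂(wilsonMeasure (d := 3) (L := L) (fundamentalRep (Fin 2)) β')) ^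
        (1 / (1 + Real.exp (4 * ((1 - 12 * |β'|) / 2) * tp))) ≤
      Real.exp (-(1 - 12 * |β'|) * s) *
        (∫ x, |G x - ∫ z, G z ∂(wilsonMeasure (d := 3) (L := L) (fundamentalRep (Fin 2)) β')| ^
          (1 + Real.exp (4 * ((1 - 12 * |β'|) / 2) * tp)) ∂(wilsonMeasure (d := 3) (L := L) (fundamentalRep (Fin 2)) β')) ^
          (1 / (1 + Real.exp (4 * ((1 - 12 * |β'|) / 2) * tp))) :=
  lpNorm_transition_centred_le_of_hypercontractive L β' κ hreal (ρ := (1 - 12 * |β'|) / 2) (by linarith)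
    (fun f hf => wilson_generatorLogSobolev_uniform L β' hβ f hf) (lam := 1 - 12 * |β'|)
    (fun G' hG' M' hM' t => wilson_spectralGap_uniform_measurable L β' hβ κ hreal hG' hM' t) hG hM tp s

end Summit.QuantumFields.YangMills.Theorems.ColdStartUniversality

end
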